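import Mathlib
import Literature.MathematicalPhysics.QuantumFieldTheory.AbelianTorusCochains
import Literature.MathematicalPhysics.QuantumFieldTheory.BlochPeriodicCochains
import HarnessLib

/-!
# The plaquette random-cluster model on the torus: cohomological weights and FKG
# (Hiraoka–Shirai 2016; Duncan–Schweinhart, CMP 406 (2025))

First file of the transcription, with the finite-volume algebra PROVED, of the Fortuin–Kasteleyn-type
("graphical") representation of `q`-state Potts lattice gauge theory:

* P. Duncan, B. Schweinhart, *Topological phases in the plaquette random-cluster model and Potts
  lattice gauge theory*, Comm. Math. Phys. **406** (2025) 145, arXiv:2207.08339 [DuncanSchweinhart2025].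
  Loci below are those of the arXiv version (v3), read in full (`lit read paper:arxiv-2207.08339`):
  §1.1 Definitions 1–3, Theorem 5; §4 eq. before §4.1, Theorem 16 (Hiraoka–Shirai: FKG lattice
  condition / positive association); §5 Propositions 20–21 (the generalised Edwards–Sokal coupling).
* Y. Hiraoka, T. Shirai, *Tutte polynomials and random-cluster models in Bernoulli cell complexes*,
  RIMS Kôkyûroku Bessatsu B59 (2016) (the model and the coupling; cited through [DuncanSchweinhart2025]).

## Scope (read this first)

Nothing in this file bears on the Clay Yang–Mills mass-gap problem for compact simple Lie groups:
the gauge group here is the finite abelian group `ℤ_q` (Potts / clock gauge theory), for which the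
large-`β` phase is a perimeter-law (Higgs/"frozen") phase, cf.
`Literature.Barriers.QuantumFields.DiscreteSubgroupFreezing`. In the `ym` ladder the conditional
finite-`𝕋⁴` rung `BalabanLadder.UV` is the only rung any current route closes; the infrared leg
`BalabanLadder.IR` (the mass gap itself) is untouched by this representation. The file is typed
because the census of "graphical representation ⇒ clustering" tools asks for the exact
Wilson-loop ↔ surface-event dictionary and the FKG structure it carries.

## Setting and readings (transcriber's, flagged at each declaration)

The source works with the `i`-dimensional plaquette random-cluster model on a general finite cubical
complex `X` and `(i-1)`-dimensional Potts lattice gauge theory. We type the case the tree speaks: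
`i = 2` (genuine LATTICE GAUGE THEORY: spins on edges, interaction on plaquettes) on the discrete
torus `X = 𝕋^d_L = (ℤ/Lℤ)^d` of `ConstructiveQFTWave0` (`Site d L`, `Plaquette d L`), with the
tree's cubical coboundaries `LatticeForm.td₀`, `LatticeForm.td₁` (`AbelianTorusCochains`,
`BlochPeriodicCochains`). `-- TODO(general form): i-cells of a general finite cubical complex.`

* (R1) A `1`-cochain (`f ∈ C¹(X; 𝒢)`, "cells with opposite orientations are mapped to inverse
  group elements") is a function on positively oriented edges, `θ : Site d L → Fin d → M`
  (`θ x i` = value on the edge `x → x + eᵢ`), exactly as in `AbelianTorusCochains`; its plaquette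
  field ("`δf`") is `res (td₁ θ) : Plaquette d L → M`.
* (R2) A plaquette configuration `ω : X² → {0,1}` (§4) is the FINSET of open plaquettes
  `ω : Finset (Plaquette d L)`; the complex `P(ω)` is the full `1`-skeleton plus the open
  plaquettes, so `C¹(P(ω)) = C¹(X)` and `Z¹(P(ω); M) = {θ : δθ = 0 on ω}` (`flatCochains`).
* (R3) Betti numbers are taken COHOMOLOGICALLY: `b₁(P; F) := dim_F H¹(P; F) = dim_F Z¹(P; F) -
  dim_F B¹(X; F)` (`bettiOne`, a quotient-module `finrank`). For field coefficients and a finite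
  complex this is the homological rank `dim_F H₁(P; F)` of Definition 1 (universal coefficients;
  the source itself computes the random-cluster marginal in this form, proof of Prop. 20:
  "`= q^{dim Z^{i-1}(P; 𝔽_q)} ∝ q^{b_{i-1}(P; 𝔽_q)}` … `B^{i-1}(P; 𝔽_q)` is fixed"). For GROUP
  coefficients (Duncan–Schweinhart, CMP (2025) "codimension two", Def. 6: weight `|H^{i-1}(P; G)|`)
  we also record `cohomologyCard`.
* (R4)–(R6) (boundary operator as the transpose of `δ`, `q`-th roots of unity, sign of the
  Hamiltonian) concern the companion files and are stated there.
* (R7) Probabilities are finite Gibbs averages (real-valued weights divided by the partition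
  function), as in `AdhikariCao2022.CorrelationDecay`; no measure theory is needed on these finite
  configuration spaces.

## Contents (everything in this file is PROVED; no named fact is introduced)

* cochain algebra on the torus: `td₁_td₀` (`δδ = 0`), `flatCochains` (`Z¹(P(ω); M)`),
  `gradCochains` (`B¹`), `CohomologyOne` (`H¹ = Z¹/B¹`), `bettiOne`, `cohomologyCard`,
  `bettiOne_add_finrank_grad` (rank–nullity);
* the plaquette random-cluster weights `weight p q ω = p^{|ω|} (1-p)^{|X²|-|ω|} q^{b₁(P(ω);F)}`
  (Def. 1), `partitionFn`, `prob`, `eventProb`, `expect`, positivity and normalisation, and the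
  group-coefficient weight `weightGrp` (`|H¹(P(ω); M)|` in place of `q^{b₁}`);
* **Theorem 16** (Hiraoka–Shirai; FKG): `bettiOne_union_add_inter` (the Mayer–Vietoris inequality
  `b₁(P ∪ P') + b₁(P ∩ P') ≥ b₁(P) + b₁(P')`, proved by `dim(U ⊓ V) + dim(U ⊔ V) = dim U + dim V`),
  `weight_mul_weight_le` (FKG lattice condition), `positive_association` (from Mathlib's
  four-functions `fkg`) and its probability form `eventProb_inter_ge`.

Potts lattice gauge theory, the Wilson loop variables, the generalised Edwards–Sokal coupling
(Prop. 20–21), the Wilson-loop/null-homology dictionary (Theorem 5) and the sharp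
homological-percolation transition on `𝕋^{2i}_N` (Theorem 8) are typed in companion files
(`PottsGaugeEdwardsSokal`, `PottsGaugeWilsonLoopTopology`).
-/

open Finset

namespace Literature.MathematicalPhysics.QuantumFieldTheory

namespace PlaquetteRC

open LatticeForm

variable {d L : ℕ}

/-! ### Cochain algebra on the torus: `δ ∘ δ = 0`, linearity -/

section CochainAlgebra

variable {R : Type*} [CommRing R] {M : Type*} [AddCommGroup M] [Module R M]

/-- `td₀` is additive. [cite: DuncanSchweinhart2025, §2.4 (cochains with coefficients in a module; δ is linear)] -/
theorem td₀_add (f g : Site d L → M) : td₀ (f + g) = td₀ f + td₀ g := by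
  funext x i; simp only [td₀, Pi.add_apply]; abel

/-- `td₀` commutes with scalars. [cite: DuncanSchweinhart2025, §2.4 (cochains with coefficients in a module; δ is linear)] -/
theorem td₀_smul (c : R) (f : Site d L → M) : td₀ (c • f) = c • td₀ f := by
  funext x i; simp only [td₀, Pi.smul_apply, smul_sub]

/-- `td₁` commutes with scalars. [cite: DuncanSchweinhart2025, §2.4 (cochains with coefficients in a module; δ is linear)] -/
theorem td₁_smul (c : R) (θ : Site d L → Fin d → M) : td₁ (c • θ) = c • td₁ θ := by
  funext x i j; simp only [td₁, Pi.smul_apply, smul_sub, smul_add]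

/-- `td₁` of a finite sum. [cite: DuncanSchweinhart2025, §2.4 (cochains with coefficients in a module; δ is linear)] -/
theorem td₁_sum {ι : Type*} (s : Finset ι) (θ : ι → Site d L → Fin d → M) :
    td₁ (∑ c ∈ s, θ c) = ∑ c ∈ s, td₁ (θ c) := by
  classical
  induction s using Finset.induction_on with
  | empty => funext x i j; simp [td₁]
  | insert a s ha ih => rw [Finset.sum_insert ha, Finset.sum_insert ha, td₁_add, ih]

/-- **`δ¹ ∘ δ⁰ = 0` on the torus**: the plaquette field of a pure gauge `td₀ f` vanishes.
[cite: DuncanSchweinhart2025, §2.4 (δδ = 0)] -/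
theorem td₁_td₀ (f : Site d L → M) : td₁ (td₀ f) = 0 := by
  funext x i j
  simp only [td₁, td₀, te, Pi.zero_apply]
  rw [add_right_comm x (Pi.single i 1) (Pi.single j 1)]
  abel

variable (R M)

/-- `td₀` as an `R`-linear map `C⁰ → C¹`. [cite: DuncanSchweinhart2025, §2.4 (cochains with coefficients in a module; δ is linear)] -/
def td₀Lin : (Site d L → M) →ₗ[R] (Site d L → Fin d → M) where
  toFun := td₀
  map_add' := td₀_add
  map_smul' := td₀_smul

/-- `td₁` as an `R`-linear map `C¹ → C²`. [cite: DuncanSchweinhart2025, §2.4 (cochains with coefficients in a module; δ is linear)] -/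
def td₁Lin : (Site d L → Fin d → M) →ₗ[R] (Site d L → Fin d → Fin d → M) where
  toFun := td₁
  map_add' := td₁_add
  map_smul' := td₁_smul

/-- `td₀Lin` is `td₀`. [cite: DuncanSchweinhart2025, §2.4 (cochains with coefficients in a module; δ is linear)] -/
@[simp] theorem td₀Lin_apply (f : Site d L → M) : td₀Lin R M f = td₀ f := rfl

/-- `td₁Lin` is `td₁`. [cite: DuncanSchweinhart2025, §2.4 (cochains with coefficients in a module; δ is linear)] -/
@[simp] theorem td₁Lin_apply (θ : Site d L → Fin d → M) : td₁Lin R M θ = td₁ θ := rfl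

/-- `Z¹(P(ω); M)`: the `1`-cochains whose plaquette field vanishes on every OPEN plaquette of the
configuration `ω` — the `1`-cocycles of the subcomplex `P(ω)` (full `1`-skeleton plus the open
plaquettes), reading (R2). [cite: DuncanSchweinhart2025, §5 (proof of Prop. 20: Z^{i-1}(P; 𝔽_q))] -/
def flatCochains (ω : Finset (Plaquette d L)) : Submodule R (Site d L → Fin d → M) where
  carrier := {θ | ∀ p ∈ ω, res (td₁ θ) p = 0}
  add_mem' := by
    intro a b ha hb p hp
    have h := congrArg (fun ω => res ω p) (td₁_add a b)
    have ha' := ha p hp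
    have hb' := hb p hp
    simp only [res, Pi.add_apply] at h ha' hb' ⊢
    rw [h, ha', hb', add_zero]
  zero_mem' := by
    intro p _
    simp [res, td₁]
  smul_mem' := by
    intro c θ hθ p hp
    have h := congrArg (fun ω => res ω p) (td₁_smul (R := R) c θ)
    have hθ' := hθ p hp
    simp only [res, Pi.smul_apply] at h hθ' ⊢
    rw [h, hθ', smul_zero]

/-- `B¹(X; M)`: the pure gauges `td₀ f` (coboundaries of `0`-cochains); it does not depend on the
plaquette configuration since `P(ω)` contains the full `1`-skeleton. [cite: DuncanSchweinhart2025, §5 (proof of Prop. 20: "B^{i-1}(P; 𝔽_q) is fixed")] -/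
def gradCochains : Submodule R (Site d L → Fin d → M) := LinearMap.range (td₀Lin (d := d) (L := L) R M)

variable {R M}

/-- Membership in `Z¹(P(ω))`: flat on every open plaquette. [cite: DuncanSchweinhart2025, §5 (proof of Prop. 20: Z^{i-1}(P), B^{i-1}(P))] -/
theorem mem_flatCochains {ω : Finset (Plaquette d L)} {θ : Site d L → Fin d → M} :
    θ ∈ flatCochains R M ω ↔ ∀ p ∈ ω, res (td₁ θ) p = 0 := Iff.rfl

/-- Membership in `B¹`: being a pure gauge `td₀ f`. [cite: DuncanSchweinhart2025, §5 (proof of Prop. 20: Z^{i-1}(P), B^{i-1}(P))] -/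
theorem mem_gradCochains {θ : Site d L → Fin d → M} :
    θ ∈ gradCochains (d := d) (L := L) R M ↔ ∃ f : Site d L → M, td₀ f = θ := by
  simp [gradCochains]

/-- `B¹ ⊆ Z¹(P(ω))` for every configuration (`δδ = 0`). [cite: DuncanSchweinhart2025, §2.4] -/
theorem gradCochains_le_flatCochains (ω : Finset (Plaquette d L)) :
    gradCochains R M ≤ flatCochains R M ω := by
  intro θ hθ
  obtain ⟨f, rfl⟩ := mem_gradCochains.mp hθ
  intro p _
  simp [res, td₁_td₀]

/-- Opening more plaquettes shrinks `Z¹`: `ω ⊆ ω' → Z¹(P(ω')) ≤ Z¹(P(ω))`. [cite: DuncanSchweinhart2025, Thm. 16 (proof: P ∩ P', P ∪ P')] -/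
theorem flatCochains_antitone {ω ω' : Finset (Plaquette d L)} (h : ω ⊆ ω') :
    flatCochains R M ω' ≤ flatCochains R M ω :=
  fun _ hθ p hp => hθ p (h hp)

/-- `Z¹(P(ω ∪ ω')) = Z¹(P(ω)) ⊓ Z¹(P(ω'))`. [cite: DuncanSchweinhart2025, Thm. 16 (proof: P ∩ P', P ∪ P')] -/
theorem flatCochains_union [DecidableEq (Plaquette d L)] (ω ω' : Finset (Plaquette d L)) :
    flatCochains R M (ω ∪ ω') = flatCochains R M ω ⊓ flatCochains R M ω' := by
  ext θ
  simp only [mem_flatCochains, Finset.mem_union, Submodule.mem_inf]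
  exact ⟨fun h => ⟨fun p hp => h p (Or.inl hp), fun p hp => h p (Or.inr hp)⟩,
    fun h p hp => hp.elim (h.1 p) (h.2 p)⟩

/-- `Z¹(P(ω)) ⊔ Z¹(P(ω')) ≤ Z¹(P(ω ∩ ω'))`. [cite: DuncanSchweinhart2025, Thm. 16 (proof: P ∩ P', P ∪ P')] -/
theorem sup_le_flatCochains_inter [DecidableEq (Plaquette d L)] (ω ω' : Finset (Plaquette d L)) :
    flatCochains R M ω ⊔ flatCochains R M ω' ≤ flatCochains R M (ω ∩ ω') :=
  sup_le (flatCochains_antitone Finset.inter_subset_left)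
    (flatCochains_antitone Finset.inter_subset_right)

variable (R M)

/-- `H¹(P(ω); M) = Z¹(P(ω); M) / B¹(X; M)`, the first cohomology of the plaquette complex `P(ω)`
(reading R3). [cite: DuncanSchweinhart2025, §2.4] -/
abbrev CohomologyOne (ω : Finset (Plaquette d L)) : Type _ :=
  ↥(flatCochains (d := d) (L := L) R M ω) ⧸
    Submodule.comap (flatCochains R M ω).subtype (gradCochains R M)

/-- `|H¹(P(ω); M)|` for a finite coefficient group — the weight of the plaquette random-cluster
model with GROUP coefficients (Duncan–Schweinhart, "codimension two", Def. 6 eq. (4):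
`μ̃(P) ∝ p^{|P|}(1-p)^{|X²|-|P|} |H̃^{i-1}(P; G)|`; for `i = 2` reduced = unreduced cohomology).
[cite: DuncanSchweinhart2025, §1.2 (the |H_i(P; ℤ_n)|-weighted model)] -/
noncomputable def cohomologyCard (ω : Finset (Plaquette d L)) : ℕ := Nat.card (CohomologyOne R M ω)

end CochainAlgebra

section Betti

variable (F : Type*) [Field F]

/-- The first Betti number `b₁(P(ω); F) = dim_F H¹(P(ω); F)` with coefficients in the field `F`
(reading R3: equal to the homological `dim_F H₁` of Definition 1). [cite: DuncanSchweinhart2025, §1.1 Def. 1 and §2] -/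
noncomputable def bettiOne (ω : Finset (Plaquette d L)) : ℕ := Module.finrank F (CohomologyOne F F ω)

variable [NeZero L]

/-- `b₁(P(ω)) + dim B¹ = dim Z¹(P(ω))` (rank–nullity for the quotient `H¹ = Z¹/B¹`; the source's
"`q^{dim Z^{i-1}(P;𝔽_q)} ∝ q^{b_{i-1}(P;𝔽_q)}` … `B^{i-1}` is fixed"). [cite: DuncanSchweinhart2025, §5 (proof of Prop. 20)] -/
theorem bettiOne_add_finrank_grad (ω : Finset (Plaquette d L)) :
    bettiOne F ω + Module.finrank F (gradCochains (d := d) (L := L) F F) =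
      Module.finrank F (flatCochains F F ω) := by
  unfold bettiOne CohomologyOne
  rw [← LinearEquiv.finrank_eq
    (Submodule.comapSubtypeEquivOfLe (gradCochains_le_flatCochains (R := F) (M := F) ω))]
  exact Submodule.finrank_quotient_add_finrank _

/-- **Mayer–Vietoris inequality for Betti numbers** (the key step of Theorem 16, eq. (11) of the
source specialised to the plaquette complexes `P(ω)`, `P(ω')`, whose union/intersection are
`P(ω ∪ ω')`, `P(ω ∩ ω')`): `b₁(P ∪ P') + b₁(P ∩ P') ≥ b₁(P) + b₁(P')`. Proof here: `Z¹(P ∪ P') =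
Z¹(P) ⊓ Z¹(P')`, `Z¹(P ∩ P') ⊇ Z¹(P) ⊔ Z¹(P')` and `dim(U ⊓ V) + dim(U ⊔ V) = dim U + dim V`.
[cite: DuncanSchweinhart2025, Thm. 16 (proof, eq. (11))] -/
theorem bettiOne_union_add_inter [DecidableEq (Plaquette d L)] (ω ω' : Finset (Plaquette d L)) :
    bettiOne F ω + bettiOne F ω' ≤ bettiOne F (ω ∪ ω') + bettiOne F (ω ∩ ω') := by
  have h1 := bettiOne_add_finrank_grad F ω
  have h2 := bettiOne_add_finrank_grad F ω'
  have h3 := bettiOne_add_finrank_grad F (ω ∪ ω')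
  have h4 := bettiOne_add_finrank_grad F (ω ∩ ω')
  have hdim := Submodule.finrank_sup_add_finrank_inf_eq (flatCochains (R := F) (M := F) ω)
    (flatCochains F F ω')
  rw [← flatCochains_union] at hdim
  have hle : Module.finrank F ↥(flatCochains (R := F) (M := F) ω ⊔ flatCochains F F ω') ≤
      Module.finrank F (flatCochains (R := F) (M := F) (ω ∩ ω')) :=
    Submodule.finrank_mono (sup_le_flatCochains_inter ω ω')
  omega

end Betti

/-! ### The plaquette random-cluster model (Definition 1, `i = 2`, `X = 𝕋^d_L`) -/

section Model

variable (F : Type*) [Field F] [NeZero L]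

/-- The plaquette random-cluster WEIGHT with coefficient field `F` and parameters `p ∈ [0,1]`,
`q > 0`: `p^{|ω|} (1-p)^{|X²|-|ω|} q^{b₁(P(ω); F)}` (Definition 1 with `i = 2` on the torus;
`|X²| - |ω|` is the number of closed plaquettes `|ωᶜ|`, no truncated subtraction).
[cite: DuncanSchweinhart2025, §1.1 Def. 1] -/
noncomputable def weight (p q : ℝ) (ω : Finset (Plaquette d L)) : ℝ :=
  p ^ ω.card * (1 - p) ^ ωᶜ.card * q ^ bettiOne F ω

/-- The normalising constant `Z(X, p, q, 2, F) = Σ_ω weight`. [cite: DuncanSchweinhart2025, §1.1 Def. 1] -/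
noncomputable def partitionFn (p q : ℝ) : ℝ := ∑ ω : Finset (Plaquette d L), weight (d := d) (L := L) F p q ω

/-- The plaquette random-cluster probability `μ_{X,p,q,2,F}(ω) = weight(ω)/Z` of a single
configuration (reading R7). [cite: DuncanSchweinhart2025, §1.1 Def. 1] -/
noncomputable def prob (p q : ℝ) (ω : Finset (Plaquette d L)) : ℝ :=
  weight F p q ω / partitionFn (d := d) (L := L) F p q

open Classical in
/-- The probability `μ_{X,p,q,2,F}(E)` of an event `E` (a set of plaquette configurations).
[cite: DuncanSchweinhart2025, §1.1 Def. 1] -/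
noncomputable def eventProb (p q : ℝ) (E : Set (Finset (Plaquette d L))) : ℝ :=
  ∑ ω : Finset (Plaquette d L), if ω ∈ E then prob F p q ω else 0

/-- The expectation `μ_{X,p,q,2,F}(f)` of a real function of the configuration. [cite: DuncanSchweinhart2025, §1.1 Def. 1] -/
noncomputable def expect (p q : ℝ) (f : Finset (Plaquette d L) → ℝ) : ℝ :=
  ∑ ω : Finset (Plaquette d L), prob F p q ω * f ω

/-- The weights are non-negative for `p ∈ [0,1]`, `q ≥ 0`. [cite: DuncanSchweinhart2025, §4.1 (proof of Thm. 16: "μ_X is strictly positive for p ∈ (0,1)")] -/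
theorem weight_nonneg {p q : ℝ} (hp : p ∈ Set.Icc (0 : ℝ) 1) (hq : 0 ≤ q) (ω : Finset (Plaquette d L)) :
    0 ≤ weight F p q ω := by
  unfold weight
  have h0 : 0 ≤ p := hp.1
  have h1 : 0 ≤ 1 - p := sub_nonneg.mpr hp.2
  positivity

/-- The weights are strictly positive for `p ∈ (0,1)`, `q > 0`. [cite: DuncanSchweinhart2025, §4.1 (proof of Thm. 16: "μ_X is strictly positive for p ∈ (0,1)")] -/
theorem weight_pos {p q : ℝ} (hp : p ∈ Set.Ioo (0 : ℝ) 1) (hq : 0 < q) (ω : Finset (Plaquette d L)) :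
    0 < weight F p q ω := by
  unfold weight
  have h1 : 0 < 1 - p := sub_pos.mpr hp.2
  have h0 : 0 < p := hp.1
  positivity

/-- `Z > 0` for `p ∈ (0,1)`, `q > 0`. [cite: DuncanSchweinhart2025, §4.1 (proof of Thm. 16: "μ_X is strictly positive for p ∈ (0,1)")] -/
theorem partitionFn_pos {p q : ℝ} (hp : p ∈ Set.Ioo (0 : ℝ) 1) (hq : 0 < q) :
    0 < partitionFn (d := d) (L := L) F p q :=
  Finset.sum_pos (fun ω _ => weight_pos F hp hq ω) Finset.univ_nonempty

/-- `μ` is a probability: `Σ_ω μ(ω) = 1` (`Z` "is a normalizing constant"). [cite: DuncanSchweinhart2025, §1.1 Def. 1] -/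
theorem sum_prob_eq_one {p q : ℝ} (hp : p ∈ Set.Ioo (0 : ℝ) 1) (hq : 0 < q) :
    ∑ ω : Finset (Plaquette d L), prob F p q ω = 1 := by
  unfold prob
  rw [← Finset.sum_div, div_eq_one_iff_eq (partitionFn_pos F hp hq).ne']
  rfl

/-- `|H¹(P(ω); M)|`-weighted model with coefficients in a finite abelian group `M`
(Duncan–Schweinhart "codimension two" Def. 6 eq. (4), `i = 2`; announced in
[DuncanSchweinhart2025] §1.2): `p^{|ω|} (1-p)^{|X²|-|ω|} |H¹(P(ω); M)|`. [cite: DuncanSchweinhart2025, §1.2] -/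
noncomputable def weightGrp (M : Type*) [AddCommGroup M] (p : ℝ) (ω : Finset (Plaquette d L)) : ℝ :=
  p ^ ω.card * (1 - p) ^ ωᶜ.card * (cohomologyCard ℤ M ω : ℝ)

/-! ### FKG: Theorem 16 (Hiraoka–Shirai) -/

/-- **FKG lattice condition** for the plaquette random-cluster weights, `p ∈ [0,1]`, `q ≥ 1`:
`w(ω) w(ω') ≤ w(ω ∩ ω') w(ω ∪ ω')` (Theorem 16, proof: `η(ω ∨ ω') + η(ω ∧ ω') = η(ω) + η(ω')` for
the plaquette counts and the Mayer–Vietoris inequality for `b₁`). [cite: DuncanSchweinhart2025, Thm. 16] -/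
theorem weight_mul_weight_le {p q : ℝ} (hp : p ∈ Set.Icc (0 : ℝ) 1) (hq : 1 ≤ q)
    (ω ω' : Finset (Plaquette d L)) :
    weight F p q ω * weight F p q ω' ≤ weight F p q (ω ⊓ ω') * weight F p q (ω ⊔ ω') := by
  classical
  have hcard : ω.card + ω'.card = (ω ∩ ω').card + (ω ∪ ω').card := by
    rw [Finset.card_inter_add_card_union]
  have hcardc : ωᶜ.card + ω'ᶜ.card = (ω ∩ ω')ᶜ.card + (ω ∪ ω')ᶜ.card := by
    rw [Finset.compl_inter, Finset.compl_union, add_comm ((ωᶜ ∪ ω'ᶜ).card),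
      Finset.card_inter_add_card_union]
  have hb := bettiOne_union_add_inter F ω ω'
  have h1 : 0 ≤ 1 - p := sub_nonneg.mpr hp.2
  unfold weight
  simp only [Finset.inf_eq_inter, Finset.sup_eq_union]
  calc p ^ ω.card * (1 - p) ^ ωᶜ.card * q ^ bettiOne F ω *
        (p ^ ω'.card * (1 - p) ^ ω'ᶜ.card * q ^ bettiOne F ω')
      = p ^ (ω.card + ω'.card) * (1 - p) ^ (ωᶜ.card + ω'ᶜ.card) *
          q ^ (bettiOne F ω + bettiOne F ω') := by ring
    _ ≤ p ^ (ω.card + ω'.card) * (1 - p) ^ (ωᶜ.card + ω'ᶜ.card) *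
          q ^ (bettiOne F (ω ∪ ω') + bettiOne F (ω ∩ ω')) := by
        apply mul_le_mul_of_nonneg_left (pow_le_pow_right₀ hq hb)
        exact mul_nonneg (pow_nonneg hp.1 _) (pow_nonneg h1 _)
    _ = p ^ (ω ∩ ω').card * (1 - p) ^ (ω ∩ ω')ᶜ.card * q ^ bettiOne F (ω ∩ ω') *
          (p ^ (ω ∪ ω').card * (1 - p) ^ (ω ∪ ω')ᶜ.card * q ^ bettiOne F (ω ∪ ω')) := by
        rw [hcard, hcardc]; ring

/-- **Theorem 16 (Hiraoka–Shirai; positive association of the plaquette random-cluster model).**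
For `p ∈ [0,1]`, `q ≥ 1` (the source states `p ∈ (0,1)`; the boundary values are harmless here) and
any two INCREASING non-negative functions `f, g` of the plaquette configuration,
`μ(f g) ≥ μ(f) μ(g)`, written without division as `(Σ w f)(Σ w g) ≤ (Σ w)(Σ w f g)`; for
indicators of increasing events this is `μ(E ∩ F) ≥ μ(E) μ(F)`. From the FKG lattice condition via
the four-functions theorem (Mathlib's `fkg`). [cite: DuncanSchweinhart2025, Thm. 16] -/
theorem positive_association {p q : ℝ} (hp : p ∈ Set.Icc (0 : ℝ) 1) (hq : 1 ≤ q)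
    {f g : Finset (Plaquette d L) → ℝ} (hf₀ : 0 ≤ f) (hg₀ : 0 ≤ g) (hf : Monotone f)
    (hg : Monotone g) :
    (∑ ω, weight F p q ω * f ω) * (∑ ω, weight F p q ω * g ω) ≤
      (∑ ω : Finset (Plaquette d L), weight F p q ω) * ∑ ω, weight F p q ω * (f ω * g ω) :=
  fkg f g (weight (d := d) (L := L) F p q) (fun ω => weight_nonneg F hp (zero_le_one.trans hq) ω)
    hf₀ hg₀ hf hg (fun ω ω' => weight_mul_weight_le F hp hq ω ω')

/-- Positive association in probability form: for increasing EVENTS `E₁, E₂` (upper sets of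
configurations) and `p ∈ (0,1)`, `q ≥ 1`, `μ(E₁ ∩ E₂) ≥ μ(E₁) μ(E₂)`. [cite: DuncanSchweinhart2025, Thm. 16] -/
theorem eventProb_inter_ge {p q : ℝ} (hp : p ∈ Set.Ioo (0 : ℝ) 1) (hq : 1 ≤ q)
    {E₁ E₂ : Set (Finset (Plaquette d L))} (h₁ : IsUpperSet E₁) (h₂ : IsUpperSet E₂) :
    eventProb F p q E₁ * eventProb F p q E₂ ≤ eventProb F p q (E₁ ∩ E₂) := by
  classical
  have hp' : p ∈ Set.Icc (0 : ℝ) 1 := ⟨hp.1.le, hp.2.le⟩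
  have hZ := partitionFn_pos (d := d) (L := L) F hp (zero_lt_one.trans_le hq)
  -- indicator functions of the two increasing events
  obtain ⟨f, hfE⟩ : ∃ f : Finset (Plaquette d L) → ℝ, ∀ ω, f ω = if ω ∈ E₁ then 1 else 0 :=
    ⟨fun ω => if ω ∈ E₁ then 1 else 0, fun _ => rfl⟩
  obtain ⟨g, hgE⟩ : ∃ g : Finset (Plaquette d L) → ℝ, ∀ ω, g ω = if ω ∈ E₂ then 1 else 0 :=
    ⟨fun ω => if ω ∈ E₂ then 1 else 0, fun _ => rfl⟩
  have hf₀ : 0 ≤ f := fun ω => by rw [Pi.zero_apply, hfE]; split_ifs <;> norm_num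
  have hg₀ : 0 ≤ g := fun ω => by rw [Pi.zero_apply, hgE]; split_ifs <;> norm_num
  have hf : Monotone f := by
    intro a b hab
    rw [hfE, hfE]
    by_cases ha : a ∈ E₁
    · rw [if_pos ha, if_pos (h₁ hab ha)]
    · rw [if_neg ha]; split_ifs <;> norm_num
  have hg : Monotone g := by
    intro a b hab
    rw [hgE, hgE]
    by_cases ha : a ∈ E₂
    · rw [if_pos ha, if_pos (h₂ hab ha)]
    · rw [if_neg ha]; split_ifs <;> norm_num
  have key := positive_association F hp' hq hf₀ hg₀ hf hg
  -- event probabilities as weighted sums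
  have hE : ∀ (E : Set (Finset (Plaquette d L))) (h : Finset (Plaquette d L) → ℝ),
      (∀ ω, ω ∈ E → h ω = 1) → (∀ ω, ω ∉ E → h ω = 0) →
      eventProb F p q E = (∑ ω, weight F p q ω * h ω) / partitionFn (d := d) (L := L) F p q := by
    intro E h h1 h0
    unfold eventProb prob
    rw [Finset.sum_div]
    refine Finset.sum_congr rfl fun ω _ => ?_
    by_cases hω : ω ∈ E
    · rw [if_pos hω, h1 ω hω, mul_one]
    · rw [if_neg hω, h0 ω hω, mul_zero, zero_div]
  have hf1 : ∀ ω, ω ∈ E₁ → f ω = 1 := fun ω h => by rw [hfE, if_pos h]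
  have hf0 : ∀ ω, ω ∉ E₁ → f ω = 0 := fun ω h => by rw [hfE, if_neg h]
  have hg1 : ∀ ω, ω ∈ E₂ → g ω = 1 := fun ω h => by rw [hgE, if_pos h]
  have hg0 : ∀ ω, ω ∉ E₂ → g ω = 0 := fun ω h => by rw [hgE, if_neg h]
  have hfg1 : ∀ ω, ω ∈ E₁ ∩ E₂ → f ω * g ω = 1 := fun ω h => by
    rw [hf1 ω h.1, hg1 ω h.2, mul_one]
  have hfg0 : ∀ ω, ω ∉ E₁ ∩ E₂ → f ω * g ω = 0 := fun ω h => by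
    rcases not_and_or.mp h with h' | h'
    · rw [hf0 ω h', zero_mul]
    · rw [hg0 ω h', mul_zero]
  rw [hE E₁ f hf1 hf0, hE E₂ g hg1 hg0, hE (E₁ ∩ E₂) (fun ω => f ω * g ω) hfg1 hfg0,
    div_mul_div_comm, div_le_div_iff₀ (mul_pos hZ hZ) hZ]
  have hZeq : partitionFn (d := d) (L := L) F p q = ∑ ω : Finset (Plaquette d L), weight F p q ω := rfl
  rw [← hZeq] at key
  calc (∑ ω, weight F p q ω * f ω) * (∑ ω, weight F p q ω * g ω) * partitionFn (d := d) (L := L) F p q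
      ≤ (partitionFn (d := d) (L := L) F p q * ∑ ω, weight F p q ω * (f ω * g ω)) *
          partitionFn (d := d) (L := L) F p q :=
        mul_le_mul_of_nonneg_right key hZ.le
    _ = (∑ ω, weight F p q ω * (f ω * g ω)) *
          (partitionFn (d := d) (L := L) F p q * partitionFn (d := d) (L := L) F p q) := by ring

end Model


end PlaquetteRC

end Literature.MathematicalPhysics.QuantumFieldTheory
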